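import Summits.QuantumFields.YangMills.Theorems.CoarseStiffnessTailCappedCoarseStiffnessLLatticeStokes
import Literature.MathematicalPhysics.QuantumFieldTheory.Balaban1983to89.T4StabilityFloorUnitary
import Literature.MathematicalPhysics.QuantumFieldTheory.Balaban1983to89.B10Eq71TorusLocal

/-!
# Route `CoarseStiffnessTail` — THE COMMUTATOR DEFECT OF THE CORNER CYCLES IS DOMINATED BY THE WILSON ACTION
# `Σ_{k<l} (1 − Re tr[h_k, h_l]) ≤ N·n²·#pairs·A(U)` on `SU(N)` (lead's certificate, seat `ym-line-cst-p1` g15; helper on 25301, stub S3, P2/(R4a))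

THE INEQUALITY (`cycleDefect_le_action`, `G = SU(N)`, every `Params`, `n = 2L^{m+K}` sites per direction, `c* = (−1,…,−1)`).  For the straight
cycles `h_k(U) = Π_{i<n} U⟨c* + i e_k, e_k⟩` through the corner and every pair `k < l`:

  `1 − Re tr(h_k h_l h_k⁻¹ h_l⁻¹) ≤ N·n²·Σ_{p ∈ (k,l)-slice through c*} (1 − Re tr U(∂p)) ≤ N·n²·A(U)`

(`one_sub_reTr_comm_le_slice`), hence `Σ_{k<l}(1 − Re tr[h_k,h_l]) ≤ N·n²·#{k<l}·A(U)`.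
PROOF.  `1 − Re tr W ≤ ½|W − 1|²` ((0.14)); lattice Stokes (`…LLatticeStokes.dist1_comm_cycles_le`): `|[h_k,h_l] − 1| ≤ Σ_{i,j<n}|U(∂p_{ij}) − 1|`;
Cauchy–Schwarz over the `n²` plaquettes of the slice; `|V − 1|² ≤ 2N(1 − Re tr V)` (tree (11)); the slice plaquettes `p_{ij} = ⟨c* + i e_k + j e_l, k, l⟩`
are distinct (`sliceMap_injOn`), so their action is part of `A(U)`.

WHY (line card §g15, P2).  With `e^{−βA} ≤ e^{−(β/2)A}·Π_𝔉 φ_{β/2}` over the corner-comb family and this bound, the factor `e^{−(β/2)A}` is dominated by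
a SPECTATOR depending only on the free corner cycles: `exp(−s·Σ_{k<l}(1 − Re tr[h_k,h_l]))`, `s = β/(2N n² #pairs)` — the input of `…LSpectatorPeeling` /
`…LCornerCycles` for the exact-exponent upper bound `Z ≤ linkMass(β/2)^{(d−1)(|T|−1)}·J_d(s)`.

HONEST SCOPE.  Deterministic algebra; nothing of Bałaban's is asserted; the crux 25301, its stubs S1/S2/S3, `HistoryTailL` 19936 stay OPEN;
`YM3TorusSU2` (R3, RECORD rung, not Clay) is NOT proved; the Yang–Mills mass gap is NOT touched.

References: T. Bałaban, CMP **102** (1985) 255–275 [Balaban1985UV3] ((11) p.258); T. Bałaban, CMP **109** (1987) 249–301 [Balaban1987RG1] ((0.14) p.254);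
I. Montvay, G. Münster, *Quantum Fields on a Lattice* (1994) §3.2.5 [MontvayMunster1994].
-/

noncomputable section

open scoped BigOperators

namespace Summit.QuantumFields.YangMills.Theorems.CoarseStiffnessTailCycleDefect

open Literature.MathematicalPhysics.QuantumFieldTheory.Balaban1983to89
open Literature.MathematicalPhysics.QuantumFieldTheory.Balaban1983to89.T4StabilityFloorUnitary
  (one_sub_reTr_le_half_dist1_sq_specialUnitary wilsonAction4_eq_sum)
open Literature.MathematicalPhysics.QuantumFieldTheory.Balaban1983to89.B10Eq71TorusLocal (dist1_sq_le_specialUnitaryGroup)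
open Summit.QuantumFields.YangMills.Theorems.CoarseStiffnessTailLatticeStokes (dist1_comm_cycles_le)

variable (N : ℕ) [NeZero N] (P : Params)

/-! ## §1 The slice through the corner: its plaquettes are distinct -/

section Slice

/-- `(i : ZMod n) = (i' : ZMod n)` with `i, i' < n` forces `i = i'`. [folklore] -/
theorem natCast_inj_of_lt {i i' : ℕ} (hi : i < P.sitesPerDir 0) (hi' : i' < P.sitesPerDir 0)
    (h : (i : ZMod (P.sitesPerDir 0)) = (i' : ZMod (P.sitesPerDir 0))) : i = i' := by
  have h1 := congrArg ZMod.val h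
  rwa [ZMod.val_cast_of_lt hi, ZMod.val_cast_of_lt hi'] at h1

/-- The slice map `(i, j) ↦ ⟨c* + i e_k + j e_l, k, l⟩` is injective on `{i < n} × {j < n}`. [folklore] -/
theorem sliceMap_injOn {k l : Fin P.d} (hkl : k < l) :
    Set.InjOn (fun ij : ℕ × ℕ => (⟨Function.update (Function.update (fun _ => (-1 : ZMod (P.sitesPerDir 0))) k
        ((-1 : ZMod (P.sitesPerDir 0)) + (ij.1 : ZMod (P.sitesPerDir 0)))) l ((-1 : ZMod (P.sitesPerDir 0)) + (ij.2 : ZMod (P.sitesPerDir 0))),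
        k, l, hkl⟩ : Plaq P 0))
      ((Finset.range (P.sitesPerDir 0) ×ˢ Finset.range (P.sitesPerDir 0) : Finset (ℕ × ℕ)) : Set (ℕ × ℕ)) := by
  intro ij hij ij' hij' h
  have hkne : k ≠ l := Fin.ne_of_lt hkl
  rw [Finset.coe_product, Set.mem_prod, Finset.mem_coe, Finset.mem_coe, Finset.mem_range, Finset.mem_range] at hij hij'
  have hsrc := congrArg Plaq.src h
  simp only at hsrc
  have hk := congrFun hsrc k
  have hl := congrFun hsrc l
  rw [Function.update_of_ne hkne, Function.update_of_ne hkne, Function.update_self, Function.update_self] at hk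
  rw [Function.update_self, Function.update_self] at hl
  have h1 : ij.1 = ij'.1 := natCast_inj_of_lt P hij.1 hij'.1 (add_left_cancel hk)
  have h2 : ij.2 = ij'.2 := natCast_inj_of_lt P hij.2 hij'.2 (add_left_cancel hl)
  exact Prod.ext h1 h2

variable {G : Type*} [GaugeGroup G]

/-- **THE SLICE ACTION IS PART OF THE ACTION**: `Σ_{i,j<n} (1 − Re tr U(∂p_{ij})) ≤ A(U)` for the slice plaquettes
`p_{ij} = ⟨c* + i e_k + j e_l, k, l⟩`, `k < l`. [folklore] -/
theorem sliceAction_le_action (U : GaugeField P 0 G) {k l : Fin P.d} (hkl : k < l) :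
    ∑ i ∈ Finset.range (P.sitesPerDir 0), ∑ j ∈ Finset.range (P.sitesPerDir 0),
        (1 - reTr (GaugeField.plaqHol U ⟨Function.update (Function.update (fun _ => (-1 : ZMod (P.sitesPerDir 0))) k
          ((-1 : ZMod (P.sitesPerDir 0)) + (i : ZMod (P.sitesPerDir 0)))) l ((-1 : ZMod (P.sitesPerDir 0)) + (j : ZMod (P.sitesPerDir 0))),
          k, l, hkl⟩)) ≤ wilsonAction4 U := by
  classical
  rw [wilsonAction4_eq_sum, ← Finset.sum_product']
  set ι := fun ij : ℕ × ℕ => (⟨Function.update (Function.update (fun _ => (-1 : ZMod (P.sitesPerDir 0))) k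
        ((-1 : ZMod (P.sitesPerDir 0)) + (ij.1 : ZMod (P.sitesPerDir 0)))) l ((-1 : ZMod (P.sitesPerDir 0)) + (ij.2 : ZMod (P.sitesPerDir 0))),
        k, l, hkl⟩ : Plaq P 0) with hι
  have hinj := sliceMap_injOn P hkl
  rw [← hι] at hinj
  have hsum : ∑ ij ∈ Finset.range (P.sitesPerDir 0) ×ˢ Finset.range (P.sitesPerDir 0), (1 - reTr (GaugeField.plaqHol U (ι ij))) =
      ∑ p ∈ (Finset.range (P.sitesPerDir 0) ×ˢ Finset.range (P.sitesPerDir 0)).image ι, (1 - reTr (GaugeField.plaqHol U p)) :=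
    (Finset.sum_image (f := fun p : Plaq P 0 => 1 - reTr (GaugeField.plaqHol U p)) hinj).symm
  rw [hsum]
  exact Finset.sum_le_sum_of_subset_of_nonneg (Finset.subset_univ _) fun p _ _ => sub_nonneg.mpr (GaugeGroup.reTr_le_one _)

end Slice

/-! ## §2 One pair: Stokes, Cauchy–Schwarz, (11), (0.14) -/

section Pair

/-- **★ THE COMMUTATOR OF TWO CORNER CYCLES IS CONTROLLED BY ITS SLICE** (`G = SU(N)`, `k < l`):
`1 − Re tr(h_k h_l h_k⁻¹ h_l⁻¹) ≤ N·n²·Σ_{i,j<n}(1 − Re tr U(∂p_{ij})) ≤ N·n²·A(U)`. [folklore] -/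
theorem one_sub_reTr_comm_le_action (U : GaugeField P 0 (Matrix.specialUnitaryGroup (Fin N) ℂ)) {k l : Fin P.d} (hkl : k < l) :
    1 - reTr (((List.range (P.sitesPerDir 0)).map fun i : ℕ => U ⟨Function.update (fun _ => (-1 : ZMod (P.sitesPerDir 0))) k
            ((-1 : ZMod (P.sitesPerDir 0)) + (i : ZMod (P.sitesPerDir 0))), k⟩).prod *
          ((List.range (P.sitesPerDir 0)).map fun j : ℕ => U ⟨Function.update (fun _ => (-1 : ZMod (P.sitesPerDir 0))) l
            ((-1 : ZMod (P.sitesPerDir 0)) + (j : ZMod (P.sitesPerDir 0))), l⟩).prod *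
          (((List.range (P.sitesPerDir 0)).map fun i : ℕ => U ⟨Function.update (fun _ => (-1 : ZMod (P.sitesPerDir 0))) k
            ((-1 : ZMod (P.sitesPerDir 0)) + (i : ZMod (P.sitesPerDir 0))), k⟩).prod)⁻¹ *
          (((List.range (P.sitesPerDir 0)).map fun j : ℕ => U ⟨Function.update (fun _ => (-1 : ZMod (P.sitesPerDir 0))) l
            ((-1 : ZMod (P.sitesPerDir 0)) + (j : ZMod (P.sitesPerDir 0))), l⟩).prod)⁻¹) ≤
      (N : ℝ) * ((P.sitesPerDir 0 : ℝ) * (P.sitesPerDir 0 : ℝ)) * wilsonAction4 U := by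
  set n : ℕ := P.sitesPerDir 0 with hn
  -- the slice summands
  set q : ℕ → ℕ → Matrix.specialUnitaryGroup (Fin N) ℂ := fun i j =>
    GaugeField.plaqHol U ⟨Function.update (Function.update (fun _ => (-1 : ZMod n)) k ((-1 : ZMod n) + (i : ZMod n))) l
      ((-1 : ZMod n) + (j : ZMod n)), k, l, hkl⟩ with hq
  -- (i) lattice Stokes at the corner
  have hstokes := dist1_comm_cycles_le P U (fun _ => (-1 : ZMod n)) (Fin.ne_of_lt hkl)
  beta_reduce at hstokes
  -- identify the Stokes summands with `dist1 (q i j)`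
  have hsum_eq : ∑ i ∈ Finset.range n, ∑ j ∈ Finset.range n, dist1
        (U ⟨Function.update (Function.update (fun _ => (-1 : ZMod n)) k ((-1 : ZMod n) + (i : ZMod n))) l ((-1 : ZMod n) + (j : ZMod n)), k⟩ *
          U ⟨Site.shift (Function.update (Function.update (fun _ => (-1 : ZMod n)) k ((-1 : ZMod n) + (i : ZMod n))) l
            ((-1 : ZMod n) + (j : ZMod n))) k, l⟩ *
          (U ⟨Site.shift (Function.update (Function.update (fun _ => (-1 : ZMod n)) k ((-1 : ZMod n) + (i : ZMod n))) l
            ((-1 : ZMod n) + (j : ZMod n))) l, k⟩)⁻¹ *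
          (U ⟨Function.update (Function.update (fun _ => (-1 : ZMod n)) k ((-1 : ZMod n) + (i : ZMod n))) l ((-1 : ZMod n) + (j : ZMod n)), l⟩)⁻¹) =
      ∑ i ∈ Finset.range n, ∑ j ∈ Finset.range n, dist1 (q i j) := by
    rfl
  rw [hsum_eq] at hstokes
  set W := ((List.range n).map fun i : ℕ => U ⟨Function.update (fun _ => (-1 : ZMod n)) k ((-1 : ZMod n) + (i : ZMod n)), k⟩).prod *
      ((List.range n).map fun j : ℕ => U ⟨Function.update (fun _ => (-1 : ZMod n)) l ((-1 : ZMod n) + (j : ZMod n)), l⟩).prod *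
      (((List.range n).map fun i : ℕ => U ⟨Function.update (fun _ => (-1 : ZMod n)) k ((-1 : ZMod n) + (i : ZMod n)), k⟩).prod)⁻¹ *
      (((List.range n).map fun j : ℕ => U ⟨Function.update (fun _ => (-1 : ZMod n)) l ((-1 : ZMod n) + (j : ZMod n)), l⟩).prod)⁻¹ with hW
  set S : ℝ := ∑ i ∈ Finset.range n, ∑ j ∈ Finset.range n, dist1 (q i j) with hS
  -- (ii) `1 − Re tr W ≤ ½ dist1(W)² ≤ ½ S²`
  have h0W : 0 ≤ dist1 W := GaugeGroup.dist1_nonneg W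
  have hS0 : 0 ≤ S := Finset.sum_nonneg fun i _ => Finset.sum_nonneg fun j _ => GaugeGroup.dist1_nonneg _
  have h1 : 1 - reTr W ≤ 1 / 2 * S ^ 2 := by
    have := one_sub_reTr_le_half_dist1_sq_specialUnitary (N := N) W
    have hsq : dist1 W ^ 2 ≤ S ^ 2 := pow_le_pow_left₀ h0W hstokes 2
    linarith
  -- (iii) Cauchy–Schwarz over the `n²` slice plaquettes and (11)
  have hCS : S ^ 2 ≤ ((n : ℝ) * (n : ℝ)) * ∑ i ∈ Finset.range n, ∑ j ∈ Finset.range n, dist1 (q i j) ^ 2 := by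
    rw [hS, ← Finset.sum_product', ← Finset.sum_product']
    have h := sq_sum_le_card_mul_sum_sq (s := Finset.range n ×ˢ Finset.range n) (f := fun ij : ℕ × ℕ => dist1 (q ij.1 ij.2))
    rw [Finset.card_product, Finset.card_range] at h
    push_cast at h
    exact h
  have h11 : ∑ i ∈ Finset.range n, ∑ j ∈ Finset.range n, dist1 (q i j) ^ 2 ≤
      2 * (N : ℝ) * ∑ i ∈ Finset.range n, ∑ j ∈ Finset.range n, (1 - reTr (q i j)) := by
    rw [Finset.mul_sum]
    refine Finset.sum_le_sum fun i _ => ?_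
    rw [Finset.mul_sum]
    refine Finset.sum_le_sum fun j _ => ?_
    have := dist1_sq_le_specialUnitaryGroup (N := N) (q i j)
    linarith
  -- (iv) the slice is part of the action
  have hslice : ∑ i ∈ Finset.range n, ∑ j ∈ Finset.range n, (1 - reTr (q i j)) ≤ wilsonAction4 U := sliceAction_le_action P U hkl
  have hN0 : (0 : ℝ) ≤ (N : ℝ) := Nat.cast_nonneg _
  have hn0 : (0 : ℝ) ≤ (n : ℝ) * (n : ℝ) := by positivity
  calc 1 - reTr W ≤ 1 / 2 * S ^ 2 := h1
    _ ≤ 1 / 2 * (((n : ℝ) * (n : ℝ)) * (2 * (N : ℝ) * ∑ i ∈ Finset.range n, ∑ j ∈ Finset.range n, (1 - reTr (q i j)))) := by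
        have := mul_le_mul_of_nonneg_left h11 hn0
        nlinarith
    _ = (N : ℝ) * ((n : ℝ) * (n : ℝ)) * ∑ i ∈ Finset.range n, ∑ j ∈ Finset.range n, (1 - reTr (q i j)) := by ring
    _ ≤ (N : ℝ) * ((n : ℝ) * (n : ℝ)) * wilsonAction4 U := mul_le_mul_of_nonneg_left hslice (by positivity)

end Pair

/-! ## §3 All pairs -/

section AllPairs

/-- **★★ THE TOTAL CYCLE DEFECT IS DOMINATED BY THE ACTION**: `Σ_{k<l}(1 − Re tr[h_k,h_l]) ≤ N·n²·#{k<l}·A(U)` (`G = SU(N)`). [folklore] -/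
theorem cycleDefect_le_action (U : GaugeField P 0 (Matrix.specialUnitaryGroup (Fin N) ℂ)) :
    ∑ kl ∈ (Finset.univ.filter fun kl : Fin P.d × Fin P.d => kl.1 < kl.2),
        (1 - reTr (((List.range (P.sitesPerDir 0)).map fun i : ℕ => U ⟨Function.update (fun _ => (-1 : ZMod (P.sitesPerDir 0))) kl.1
            ((-1 : ZMod (P.sitesPerDir 0)) + (i : ZMod (P.sitesPerDir 0))), kl.1⟩).prod *
          ((List.range (P.sitesPerDir 0)).map fun j : ℕ => U ⟨Function.update (fun _ => (-1 : ZMod (P.sitesPerDir 0))) kl.2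
            ((-1 : ZMod (P.sitesPerDir 0)) + (j : ZMod (P.sitesPerDir 0))), kl.2⟩).prod *
          (((List.range (P.sitesPerDir 0)).map fun i : ℕ => U ⟨Function.update (fun _ => (-1 : ZMod (P.sitesPerDir 0))) kl.1
            ((-1 : ZMod (P.sitesPerDir 0)) + (i : ZMod (P.sitesPerDir 0))), kl.1⟩).prod)⁻¹ *
          (((List.range (P.sitesPerDir 0)).map fun j : ℕ => U ⟨Function.update (fun _ => (-1 : ZMod (P.sitesPerDir 0))) kl.2
            ((-1 : ZMod (P.sitesPerDir 0)) + (j : ZMod (P.sitesPerDir 0))), kl.2⟩).prod)⁻¹)) ≤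
      (N : ℝ) * ((P.sitesPerDir 0 : ℝ) * (P.sitesPerDir 0 : ℝ)) *
        ((Finset.univ.filter fun kl : Fin P.d × Fin P.d => kl.1 < kl.2).card : ℝ) * wilsonAction4 U := by
  have h := Finset.sum_le_sum (s := Finset.univ.filter fun kl : Fin P.d × Fin P.d => kl.1 < kl.2)
    (fun kl hkl => one_sub_reTr_comm_le_action N P U (Finset.mem_filter.1 hkl).2)
  refine h.trans (le_of_eq ?_)
  rw [Finset.sum_const, nsmul_eq_mul]
  ring

end AllPairs

end Summit.QuantumFields.YangMills.Theorems.CoarseStiffnessTailCycleDefect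

end
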